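import Mathlib
import HarnessLib
import Literature.Analysis.FluidPDE.Tao2016AveragedNS.TaylorChainCertificate
import Summits.NavierStokesRegularity.NavierStokesRegularity.Theses.ExactWindowRungThree

/-!
# Line `taylor-model` on crux K1b-DR (`ExactWindowRungThree.DerivativeEnclosureCertificateR`,
# stmt-NavierStokesRegularity-23954) — the three stub statements S1 / K / G as tree definitions

Definitions-only file (no theorems, no sorry): the propositions `TaylorModelSoundness` (S1, abstract
Cauchy-majorant soundness of Taylor models for a quadratic field on `Fin n → ℝ`),
`TaylorModelChainCertificate` (K, `∃ d : TaylorChain.CertData, d.Valid` over the landed Literature module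
p593471) and `TaylorModelReadout` (G, `S1 → K → K1b-DR`), VERBATIM from the registered skeleton v3 of the
line (`Cruxes/DerivativeEnclosureCertificateR/Lines/taylor-model.lean`, sha16 `9391589be9c875b2`, ideator
ns-idea-2 g3), so that the stub provers (S1: typer seat; K: ns-wr3-cert-1; G0–G4: engine-1 and successors)
state their by-name theorems `theorem stub_soundness : TaylorModelSoundness`, … against ONE tree
declaration each (namespace `…Theorems.TaylorModel`; `open` it). MODEL-lattice rung TL-M3 only: nothing here
is a statement about the Navier–Stokes equations, and nothing is asserted (definitions only).
-/

set_option linter.dupNamespace false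

noncomputable section

namespace Summit.NavierStokesRegularity.NavierStokesRegularity.Theorems.TaylorModel

open scoped BigOperators
open Set
/-- S1 · analytic soundness of Taylor models for quadratic fields (method of majorants), abstract over the
dimension `n`, a bilinear `Q` with weighted operator bound `b`, Taylor / variational coefficient recursions. -/
def TaylorModelSoundness : Prop :=
  ∀ (n : ℕ) (Q : (Fin n → ℝ) → (Fin n → ℝ) → Fin n → ℝ) (w : Fin n → ℝ) (b : ℝ)
    (T : (Fin n → ℝ) → ℕ → Fin n → ℝ) (U : (Fin n → ℝ) → (Fin n → ℝ) → ℕ → Fin n → ℝ),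
    (∀ c, 0 < w c) → 0 ≤ b →
    (∀ u, IsLinearMap ℝ (Q u)) → (∀ v, IsLinearMap ℝ (fun u => Q u v)) →
    (∀ (u v : Fin n → ℝ) (Nu Nv : ℝ), 0 ≤ Nu → 0 ≤ Nv → (∀ c, |u c| ≤ Nu * w c) → (∀ c, |v c| ≤ Nv * w c) →
      ∀ c, |Q u v c| ≤ b * Nu * Nv * w c) →
    (∀ x, T x 0 = x) →
    (∀ x (k : ℕ) c, ((k : ℝ) + 1) * T x (k + 1) c =
        ∑ i ∈ Finset.range (k + 1), Q (T x i) (T x (k - i)) c) →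
    (∀ x v, U x v 0 = v) →
    (∀ x v (k : ℕ) c, ((k : ℝ) + 1) * U x v (k + 1) c =
        ∑ i ∈ Finset.range (k + 1), (Q (T x i) (U x v (k - i)) c + Q (U x v (k - i)) (T x i) c)) →
    ∃ Φ : (Fin n → ℝ) → ℝ → Fin n → ℝ,
      (∀ x, Φ x 0 = x) ∧
      (∀ (x : Fin n → ℝ) (t : ℝ) (ψ : ℝ → Fin n → ℝ), 0 ≤ t → ψ 0 = x →
        (∀ s ∈ Icc 0 t, HasDerivWithinAt ψ (Q (ψ s) (ψ s)) (Icc 0 t) s) → ∀ s ∈ Icc 0 t, ψ s = Φ x s) ∧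
      ∀ (x : Fin n → ℝ) (m t : ℝ), 0 ≤ m → (∀ c, |x c| ≤ m * w c) → 0 ≤ t → b * m * t < 1 →
        (∀ s ∈ Icc 0 t, HasDerivWithinAt (Φ x) (Q (Φ x s) (Φ x s)) (Icc 0 t) s) ∧
        (∀ (k : ℕ) c, |T x k c| ≤ m * (b * m) ^ k * w c) ∧
        (∀ s ∈ Icc 0 t, ∀ c, |Φ x s c| ≤ m / (1 - b * m * s) * w c) ∧
        (∀ s ∈ Icc 0 t, ∀ (p : ℕ) c,
          |Φ x s c - ∑ k ∈ Finset.range (p + 1), T x k c * s ^ k| ≤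
            m * (b * m * s) ^ (p + 1) / (1 - b * m * s) * w c) ∧
        (∀ (v : Fin n → ℝ) (ρ : ℝ), 0 ≤ ρ → (∀ c, |v c| ≤ ρ * w c) → b * (m + ρ) * t < 1 →
          (∀ (k : ℕ) c, |U x v k c| ≤ ((k : ℝ) + 1) * ρ * (b * m) ^ k * w c) ∧
          (∀ s ∈ Icc 0 t, ∀ c,
            |Φ (x + v) s c - Φ x s c| ≤ ((m + ρ) / (1 - b * (m + ρ) * s) - m / (1 - b * m * s)) * w c) ∧
          (∀ s ∈ Icc 0 t, ∀ (p : ℕ) c,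
            |Φ (x + v) s c - Φ x s c - ∑ k ∈ Finset.range (p + 1), U x v k c * s ^ k| ≤
              ((m + ρ) / (1 - b * (m + ρ) * s) - m / (1 - b * m * s) - ρ / (1 - b * m * s) ^ 2 +
                ρ * ((((p : ℝ) + 2) * (b * m * s) ^ (p + 1) - ((p : ℝ) + 1) * (b * m * s) ^ (p + 2)) /
                  (1 - b * m * s) ^ 2)) * w c) ∧
          (∀ s ∈ Icc 0 t, ∃ L : (Fin n → ℝ) →L[ℝ] (Fin n → ℝ),
            HasFDerivAt (fun y => Φ y s) L (x + v) ∧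
            (∀ (z : Fin n → ℝ) (ζ : ℝ), 0 ≤ ζ → (∀ c, |z c| ≤ ζ * w c) →
              ∀ c, |L z c| ≤ ζ / (1 - b * (m + ρ) * s) ^ 2 * w c) ∧
            (∀ (z : Fin n → ℝ) (ζ : ℝ) (p : ℕ), 0 ≤ ζ → (∀ c, |z c| ≤ ζ * w c) →
              ∀ c, |L z c - ∑ k ∈ Finset.range (p + 1), U x z k c * s ^ k| ≤
                ζ * ((((p : ℝ) + 2) * (b * m * s) ^ (p + 1) - ((p : ℝ) + 1) * (b * m * s) ^ (p + 2)) /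
                    (1 - b * m * s) ^ 2 +
                  (1 / (1 - b * (m + ρ) * s) ^ 2 - 1 / (1 - b * m * s) ^ 2)) * w c)))

/-- K · the flow-free chain certificate exists (the certificate engine's output, checked clause by clause). -/
def TaylorModelChainCertificate : Prop :=
  ∃ d : Literature.Analysis.FluidPDE.TaoCascade.TaylorChain.CertData, d.Valid

/-- G · readout: soundness + certificate ⇒ K1b-DR (instantiate S1 with n = 4(Ka+Kb+1) window coordinates,
`Q = d.Qb`, weights `d.ω j`, along every sub-step; crossing time from the section clauses; (LIP) from the
products; (LANDING C¹) from `β ≥ NDL·ΛX·dm`). -/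
def TaylorModelReadout : Prop :=
  TaylorModelSoundness → TaylorModelChainCertificate →
    Summit.NavierStokesRegularity.NavierStokesRegularity.Theses.ExactWindowRungThree.DerivativeEnclosureCertificateR

end Summit.NavierStokesRegularity.NavierStokesRegularity.Theorems.TaylorModel

end
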